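import Summits.Langlands.Langlands.Theses.EvenSkinnerWilesMirror
import Literature.NumberTheory.Automorphic.BaseChangeArchimedeanCentralCharacter
import Literature.NumberTheory.Automorphic.BaseChangeArchimedean

/-!
# Birth skeleton of the piece X₂ `DescentWeightParity` (child of crux stmt-Langlands-15309 `BianchiMirrorParity`)

Stubs: (A) THE CENTRAL-CHARACTER EXPONENT (new lemma, L — the normalisation content of the lever): for `π` on
`GL₂(𝔸_K)` Satake–Frobenius compatible a.e. with `ρ|_K`, `det(ρ)^N = ε^{(k-1)N}`, every archimedean parameter `χ`
of `π` has `∑ χ(τ) = k - 1` at every `τ : K → ℂ` (`ι(det ρ(Frob_w)) = ω_π(ϖ_w)⁻¹` in the arithmetic-Frobenius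
`L`-normalised dictionary; `ω_π^N = ‖·‖_K^{(k-1)N}` by rigidity of Hecke characters; differential of `ω_π`);
(F) existence of infinity types (Clozel §3.3; the tree's per-datum named fact `exists_hasInfinityType`).
`DescentWeightParity_of` composes them with the PROVED restriction of exponent sums along weak base change
(`AutomorphicRepData.sum_archParameter_eq_of_isWeakBaseChangeLiftAE`, Arthur–Clozel Prop. 4.4 (ii)), extends the
embedding of `ℚ` to `K`, and does the parity arithmetic (`k` even ⇒ `k - 1` odd).
-/

set_option linter.dupNamespace false

namespace Summit.Langlands.Langlands.Cruxes.BianchiMirrorParity.DescentWeightParityBirth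

open Filter
open Literature.NumberTheory.Automorphic Literature.NumberTheory.GaloisRepresentations

/-- STUB (A) (new lemma, L): **the exponent of the central character.**  If `π` on `GL₂(𝔸_K)` is Satake–Frobenius
compatible at cofinitely many `w` with `ρ|_{Γ_K}` for an a.e. unramified `ρ : Γ_ℚ → GL₂(ℚ̄_p)` with
`det(ρ)^N = ε^{(k-1)N}`, then every archimedean parameter `χ` of `π` has `∑ χ(τ) = k - 1` for all `τ : K → ℂ`:
`ι(det ρ(Frob_w)) = (∏ t_{π,w})⁻¹ = ω_π(ϖ_w)⁻¹` (`AutomorphicRepData.exists_centralCharacter`), so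
`ω_π(ϖ_w)^N = ‖ϖ_w‖^{(k-1)N}` a.e. and `ω_π^N = ‖·‖_K^{(k-1)N}`
(`HeckeCharacter.ext_of_eventually_valueAtUniformizer_eq`), whose differential, read through
`HasArchParameter.apply_scalar` / `centralCharacter_det_ofInfinite_expGL`, is `N ∑ χ(τ) = (k-1)N`. [folklore] -/
theorem stub_sum_archParameter_eq : ∀ (p : ℕ) [Fact p.Prime] (K : Type) [Field K] [NumberField K], NumberField.IsTotallyComplex K → Module.finrank ℚ K = 2 → ∀ (hcpt : Literature.NumberTheory.Automorphic.isCompact_glFiniteIntegralLevel 2 K) (ι : PadicAlgCl p ≃+* ℂ) (ρ : Literature.NumberTheory.GaloisRepresentations.FramedGaloisRep ℚ (PadicAlgCl p) 2) (π : Literature.NumberTheory.Automorphic.CuspidalAutomorphicRepData 2 K hcpt), (∀ᶠ v in cofinite, ρ.IsUnramifiedAt v) → ∀ (k N : ℕ), 0 < N → (∀ g : Field.absoluteGaloisGroup ℚ, ((Matrix.GeneralLinearGroup.det (ρ g) : (PadicAlgCl p)ˣ) : PadicAlgCl p) ^ N = algebraMap (Padic p) (PadicAlgCl p) (((Literature.NumberTheory.GaloisRepresentations.GaloisRep.cyclotomicCharacter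 ℚ p g).val : PadicInt p) : Padic p) ^ ((k - 1) * N)) → (∀ᶠ w in cofinite, Summit.Langlands.SatakeFrobCompatibleAt ι π.1 (ρ.restrictField K) w) → ∀ χ : (K →+* ℂ) → Multiset ℂ, π.1.HasArchParameter χ → ∀ τ : K →+* ℂ, (χ τ).sum = ((k - 1 : ℕ) : ℂ) := by
  sorry

/-- STUB-FACT (F): every cuspidal automorphic representation of `GL₂(𝔸_K)` has an infinity type (Clozel 1990 §3.3,
Harish-Chandra; the tree's per-datum named fact `AutomorphicRepData.exists_hasInfinityType`). [cite: Clozel1990, §3.3] -/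
theorem stub_exists_hasInfinityType : ∀ (K : Type) [Field K] [NumberField K] (hcpt : Literature.NumberTheory.Automorphic.isCompact_glFiniteIntegralLevel 2 K) (π : Literature.NumberTheory.Automorphic.CuspidalAutomorphicRepData 2 K hcpt), π.1.exists_hasInfinityType := by
  sorry

/-- **COMPOSITION (no sorry): the stubs imply X₂ `DescentWeightParity`.**  Take any infinity type `T₀` of the
`L`-algebraic `π₀` and `m := k - 1` (odd, `k` being even); for `σ : ℚ → ℂ` extend to `τ : K → ℂ`; by the proved
Arthur–Clozel Prop. 4.4 (ii) (`sum_archParameter_eq_of_isWeakBaseChangeLiftAE`) the `a`-exponent sum of `T₀` at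
`σ = τ|_ℚ` is the exponent sum of `π` at `τ`, which is `k - 1` by stub (A) (with an infinity type of `π` from (F)).
[folklore] -/
theorem DescentWeightParity_of :
    (∀ (p : ℕ) [Fact p.Prime] (K : Type) [Field K] [NumberField K], NumberField.IsTotallyComplex K → Module.finrank ℚ K = 2 → ∀ (hcpt : Literature.NumberTheory.Automorphic.isCompact_glFiniteIntegralLevel 2 K) (ι : PadicAlgCl p ≃+* ℂ) (ρ : Literature.NumberTheory.GaloisRepresentations.FramedGaloisRep ℚ (PadicAlgCl p) 2) (π : Literature.NumberTheory.Automorphic.CuspidalAutomorphicRepData 2 K hcpt), (∀ᶠ v in cofinite, ρ.IsUnramifiedAt v) → ∀ (k N : ℕ), 0 < N → (∀ g : Field.absoluteGaloisGroup ℚ, ((Matrix.GeneralLinearGroup.det (ρ g) : (PadicAlgCl p)ˣ) : PadicAlgCl p) ^ N = algebraMap (Padic p) (PadicAlgCl p) (((Literature.NumberTheory.GaloisRepresentations.GaloisRep.cyclotomicCharacter ℚ p g).val : PadicInt p) : Padic p) ^ ((k - 1) * N)) → (∀ᶠ w in cofinite, Summit.Langlands.SatakeFrobCompatibleAt ι π.1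 (ρ.restrictField K) w) → ∀ χ : (K →+* ℂ) → Multiset ℂ, π.1.HasArchParameter χ → ∀ τ : K →+* ℂ, (χ τ).sum = ((k - 1 : ℕ) : ℂ)) →
    (∀ (K : Type) [Field K] [NumberField K] (hcpt : Literature.NumberTheory.Automorphic.isCompact_glFiniteIntegralLevel 2 K) (π : Literature.NumberTheory.Automorphic.CuspidalAutomorphicRepData 2 K hcpt), π.1.exists_hasInfinityType) →
      (∀ (p : ℕ) [Fact p.Prime] (K : Type) [Field K] [NumberField K], NumberField.IsTotallyComplex K → Module.finrank ℚ K = 2 → ∀ (hcpt : Literature.NumberTheory.Automorphic.isCompact_glFiniteIntegralLevel 2 K) (hℚ : Literature.NumberTheory.Automorphic.isCompact_glFiniteIntegralLevel 2 ℚ) (ι : PadicAlgCl p ≃+* ℂ) (ρ : Literature.NumberTheory.GaloisRepresentations.FramedGaloisRep ℚ (PadicAlgCl p) 2) (π : Literature.NumberTheory.Automorphic.CuspidalAutomorphicRepData 2 K hcpt) (π₀ : Literature.NumberTheory.Automorphic.CuspidalAutomorphicRepData 2 ℚ hℚ), (∀ᶠ v in cofinite, ρ.IsUnramifiedAt v)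 → (∃ k N : ℕ, 2 ≤ k ∧ Even k ∧ 0 < N ∧ ∀ g : Field.absoluteGaloisGroup ℚ, ((Matrix.GeneralLinearGroup.det (ρ g) : (PadicAlgCl p)ˣ) : PadicAlgCl p) ^ N = algebraMap (Padic p) (PadicAlgCl p) (((Literature.NumberTheory.GaloisRepresentations.GaloisRep.cyclotomicCharacter ℚ p g).val : PadicInt p) : Padic p) ^ ((k - 1) * N)) → (∀ᶠ w in cofinite, Summit.Langlands.SatakeFrobCompatibleAt ι π.1 (ρ.restrictField K) w) → Literature.NumberTheory.Automorphic.IsWeakBaseChangeLiftAE π₀.1 π.1 → π₀.1.IsLAlgebraic → ∃ T : Literature.NumberTheory.Automorphic.InfinityType ℚ 2, π₀.1.HasInfinityType T ∧ T.IsLAlgebraic ∧ ∃ m : ℤ, Odd m ∧ ∀ σ : ℚ →+* ℂ, ((T σ).map Literature.NumberTheory.Automorphic.ArchWeight.a).sum = (m : ℂ)) := by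
  intro hA hF
  intro p _ K _ _ hKc hK2 hcpt hℚ ι ρ π π₀ hunr hdet hπsat hBC hπ₀L
  obtain ⟨k, N, hk2, hkev, hN, hdet⟩ := hdet
  obtain ⟨T₀, hT₀, hT₀L⟩ := hπ₀L
  obtain ⟨TK, hTK⟩ := hF K hcpt π
  haveI : FiniteDimensional ℚ K := Module.finite_of_finrank_eq_succ hK2
  haveI : Algebra.IsQuadraticExtension ℚ K := ⟨hK2⟩
  haveI : IsGalois ℚ K := inferInstance
  refine ⟨T₀, hT₀, hT₀L, (k : ℤ) - 1, ?_, ?_⟩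
  · obtain ⟨j, hj⟩ := hkev
    refine ⟨(j : ℤ) - 1, ?_⟩
    omega
  · intro σ
    obtain ⟨τ, hτ⟩ := ArthurClozel1989_strongLifting_archimedean.exists_comp_algebraMap_eq (E := K) σ
    have h1 := AutomorphicRepData.sum_archParameter_eq_of_isWeakBaseChangeLiftAE hBC hT₀.2 hTK.2 τ
    have h2 := hA p K hKc hK2 hcpt ι ρ π hunr k N hN hdet hπsat _ hTK.2 τ
    rw [hτ] at h1
    rw [← h1, h2]
    have hk1 : 1 ≤ k := by omega
    push_cast [Nat.cast_sub hk1]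
    ring

/-- X₂ from the stubs. [folklore] -/
theorem descentWeightParity_of_stubs : (∀ (p : ℕ) [Fact p.Prime] (K : Type) [Field K] [NumberField K], NumberField.IsTotallyComplex K → Module.finrank ℚ K = 2 → ∀ (hcpt : Literature.NumberTheory.Automorphic.isCompact_glFiniteIntegralLevel 2 K) (hℚ : Literature.NumberTheory.Automorphic.isCompact_glFiniteIntegralLevel 2 ℚ) (ι : PadicAlgCl p ≃+* ℂ) (ρ : Literature.NumberTheory.GaloisRepresentations.FramedGaloisRep ℚ (PadicAlgCl p) 2) (π : Literature.NumberTheory.Automorphic.CuspidalAutomorphicRepData 2 K hcpt) (π₀ : Literature.NumberTheory.Automorphic.CuspidalAutomorphicRepData 2 ℚ hℚ), (∀ᶠ v in cofinite, ρ.IsUnramifiedAt v) → (∃ k N : ℕ, 2 ≤ k ∧ Even k ∧ 0 < N ∧ ∀ g : Field.absoluteGaloisGroup ℚ, ((Matrix.GeneralLinearGroup.det (ρ g) : (PadicAlgCl p)ˣ) : PadicAlgCl p) ^ N = algebraMap (Padic p) (PadicAlgCl p) (((Literature.NumberTheory.GaloisRepresentations.GaloisRep.cyclotomicCharacter ℚ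 p g).val : PadicInt p) : Padic p) ^ ((k - 1) * N)) → (∀ᶠ w in cofinite, Summit.Langlands.SatakeFrobCompatibleAt ι π.1 (ρ.restrictField K) w) → Literature.NumberTheory.Automorphic.IsWeakBaseChangeLiftAE π₀.1 π.1 → π₀.1.IsLAlgebraic → ∃ T : Literature.NumberTheory.Automorphic.InfinityType ℚ 2, π₀.1.HasInfinityType T ∧ T.IsLAlgebraic ∧ ∃ m : ℤ, Odd m ∧ ∀ σ : ℚ →+* ℂ, ((T σ).map Literature.NumberTheory.Automorphic.ArchWeight.a).sum = (m : ℂ)) :=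
  DescentWeightParity_of stub_sum_archParameter_eq stub_exists_hasInfinityType

end Summit.Langlands.Langlands.Cruxes.BianchiMirrorParity.DescentWeightParityBirth
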